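import Mathlib
import Literature.Probability.Percolation.SelfRefinementMeasure
import Literature.Probability.LatticeModels.ProdBernoulliIndependence
import Literature.Probability.Percolation.CoveringQuotientBlocks
import HarnessLib

/-!
# The coarse shadow of the self-refinement coins is subcritical bond percolation

Helper file for the stub `stub_boundaryValues` of the line `Sketch` (crux
`stmt-CriticalPhenomena-10269`, `…Theses.CardySelfRefinement.GradientComparability`), boundary
value `c = 0` of the self-refinement model `M_k(ρ, c)`.

## Mathematics

Group the coins of `M_k(ρ, c)` read by the first two sub-edges of the coarse edge `{kC, kC + k e_d}`
of `kℤ²`: the selector `(C, d, 2)` (bias `ρ̂ = projIcc ρ`), the shared coin `(C, d, 1)` (fair)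
and the own coins `(kC, d, 0)`, `(kC + e_d, d, 0)` of the sub-edges `0` and `1` (fair, the
sub-edges being axial).  These blocks of four coins are pairwise disjoint (`k ≥ 2`), so the
*coarse shadow* — the set of coarse edges whose block shows
`(selector ∧ shared) ∨ (¬ selector ∧ own₀ ∧ own₁)` — is an independent bond percolation on `ℤ²`
with parameter `q(ρ) = ρ̂/2 + (1 - ρ̂)/4` (`prodBernoulli_map_coarseShadow`; transport of the
product measure: pull back along the block injection, curry, push the four-coin Boolean map
through the outer product, `pi_bernoulli_map_block`).  A coarse edge all of whose `k` sub-edges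
are open in the configuration `cfg k S` has its first two sub-edges open, hence lies in the
shadow (`coarse_mem_shadow_h`, `coarse_mem_shadow_v`).  For `ρ ≤ 1 - δ`,
`q(ρ) ≤ 1/2 - δ/4 < 1/2 = p_c(ℤ²)`.
-/

noncomputable section

namespace Summit.CriticalPhenomena.CardyFormulaZ2.Theorems.CardySelfRefinement

open Set MeasureTheory Measure ProbabilityTheory unitInterval
open Literature.Probability.LatticeModels Literature.Probability.Percolation
open scoped ENNReal

variable {ι : Type*}

/-! ## A block of four coins read through one Boolean function -/

/-- The block parameter `p₀ p₁ + (1 - p₀) p₂ p₃` lies in `[0, 1]`. -/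
theorem blockParam_mem (p : Fin 4 → unitInterval) :
    (p 0 : ℝ) * p 1 + (1 - p 0) * (p 2 * p 3) ∈ Icc (0 : ℝ) 1 := by
  have h0 := (p 0).2; have h1 := (p 1).2; have h2 := (p 2).2; have h3 := (p 3).2
  simp only [mem_Icc] at h0 h1 h2 h3
  constructor <;> nlinarith [mul_nonneg h2.1 h3.1, mul_le_one₀ h2.2 h3.1 h3.2]

/-- **The four-coin computation**: for independent coins `g 0, …, g 3` with biases `p 0, …, p 3`,
the Boolean `(g 0 ∧ g 1) ∨ (¬ g 0 ∧ g 2 ∧ g 3)` shows `True` with probability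
`p₀ p₁ + (1 - p₀) p₂ p₃`. -/
theorem pi_bernoulli_map_block (p : Fin 4 → unitInterval) :
    (Measure.pi fun j : Fin 4 => Ber(True, False, p j)).map
        (fun g : Fin 4 → Prop => (g 0 ∧ g 1) ∨ (¬ g 0 ∧ g 2 ∧ g 3)) =
      Ber(True, False, ⟨(p 0 : ℝ) * p 1 + (1 - p 0) * (p 2 * p 3), blockParam_mem p⟩) := by
  have hmeas : Measurable (fun g : Fin 4 → Prop => (g 0 ∧ g 1) ∨ (¬ g 0 ∧ g 2 ∧ g 3)) :=
    measurable_of_countable _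
  haveI : IsProbabilityMeasure ((Measure.pi fun j : Fin 4 => Ber(True, False, p j)).map
      (fun g : Fin 4 → Prop => (g 0 ∧ g 1) ∨ (¬ g 0 ∧ g 2 ∧ g 3))) :=
    isProbabilityMeasure_map hmeas.aemeasurable
  refine StarCoins.measure_prop_ext ?_
  rw [Measure.map_apply hmeas (measurableSet_singleton True)]
  -- the event is the disjoint union of two cylinders
  set A : Set (Fin 4 → Prop) := Set.pi univ ![{True}, {True}, univ, univ] with hA
  set B : Set (Fin 4 → Prop) := Set.pi univ ![{False}, univ, {True}, {True}] with hB
  have hpre : (fun g : Fin 4 → Prop => (g 0 ∧ g 1) ∨ (¬ g 0 ∧ g 2 ∧ g 3)) ⁻¹' {True} = A ∪ B := by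
    ext g
    simp only [mem_preimage, mem_singleton_iff, eq_iff_iff, iff_true, hA, hB, mem_union, mem_pi,
      mem_univ, forall_const]
    constructor
    · rintro (⟨h0, h1⟩ | ⟨h0, h2, h3⟩)
      · left; intro j; fin_cases j <;> simp [h0, h1]
      · right; intro j; fin_cases j <;> simp [h0, h2, h3]
    · rintro (h | h)
      · have h0 := h 0; have h1 := h 1
        simp only [Fin.isValue, Matrix.cons_val_zero, Matrix.cons_val_one,
          mem_singleton_iff, eq_iff_iff, iff_true] at h0 h1
        exact Or.inl ⟨h0, h1⟩
      · have h0 := h 0; have h2 := h 2; have h3 := h 3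
        simp only [Fin.isValue, Matrix.cons_val_zero, Matrix.cons_val, mem_singleton_iff,
          eq_iff_iff, iff_true, iff_false] at h0 h2 h3
        exact Or.inr ⟨h0, h2, h3⟩
  have hdisj : Disjoint A B := by
    rw [Set.disjoint_left]
    intro g hgA hgB
    have h1 : g 0 ∈ ({True} : Set Prop) := hgA 0 (mem_univ _)
    have h2 : g 0 ∈ ({False} : Set Prop) := hgB 0 (mem_univ _)
    simp only [mem_singleton_iff] at h1 h2
    exact (h2 ▸ h1 : False = True) ▸ trivial |> fun h => by simp_all
  have hBm : MeasurableSet B := MeasurableSet.univ_pi fun _ => MeasurableSpace.measurableSet_top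
  rw [hpre, measure_union hdisj hBm, hA, hB, Measure.pi_pi, Measure.pi_pi, Fin.prod_univ_four,
    Fin.prod_univ_four]
  simp only [Fin.isValue, Matrix.cons_val_zero, Matrix.cons_val_one, Matrix.cons_val,
    measure_univ, mul_one, bernoulliMeasure_prop_apply_true, bernoulliMeasure_prop_apply_false]
  have h0 := (p 0).2.1; have h0' := sub_nonneg.2 (p 0).2.2; have h1 := (p 1).2.1
  have h2 := (p 2).2.1; have h3 := (p 3).2.1
  rw [← ENNReal.ofReal_mul h0, ← ENNReal.ofReal_mul h0', ← ENNReal.ofReal_mul (mul_nonneg h0' h2),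
    ← ENNReal.ofReal_add (mul_nonneg h0 h1) (mul_nonneg (mul_nonneg h0' h2) h3)]
  congr 1
  ring

-- adapted from `Literature.Probability.LatticeModels.prodBernoulli_map_superpose`
/-- **Reading disjoint blocks of four coins through one Boolean function.**  Under
`prodBernoulli P` on `Set (ι × Fin 4)`, the configuration
`{i | ((i,0) ∈ ξ ∧ (i,1) ∈ ξ) ∨ ((i,0) ∉ ξ ∧ (i,2) ∈ ξ ∧ (i,3) ∈ ξ)}` has law `prodBernoulli`
with parameters `P(i,0) P(i,1) + (1 - P(i,0)) P(i,2) P(i,3)`. -/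
theorem prodBernoulli_map_block (P : ι × Fin 4 → unitInterval) :
    (prodBernoulli P).map (fun ξ : Set (ι × Fin 4) =>
        {i | ((i, 0) ∈ ξ ∧ (i, 1) ∈ ξ) ∨ ((i, 0) ∉ ξ ∧ (i, 2) ∈ ξ ∧ (i, 3) ∈ ξ)}) =
      prodBernoulli (fun i => ⟨(P (i, 0) : ℝ) * P (i, 1) + (1 - P (i, 0)) * (P (i, 2) * P (i, 3)),
        blockParam_mem fun j => P (i, j)⟩) := by
  have hor : Measurable (fun g : Fin 4 → Prop => (g 0 ∧ g 1) ∨ (¬ g 0 ∧ g 2 ∧ g 3)) :=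
    measurable_of_countable _
  have hpi : Measurable (fun (h : ι → Fin 4 → Prop) (i : ι) =>
      (h i 0 ∧ h i 1) ∨ (¬ h i 0 ∧ h i 2 ∧ h i 3)) :=
    measurable_pi_lambda _ fun i => hor.comp (measurable_pi_apply i)
  have hset : Measurable (fun q : ι → Prop => {i | q i}) := measurable_setOf
  have hproj : Measurable (fun ξ : Set (ι × Fin 4) =>
      {i | ((i, 0) ∈ ξ ∧ (i, 1) ∈ ξ) ∨ ((i, 0) ∉ ξ ∧ (i, 2) ∈ ξ ∧ (i, 3) ∈ ξ)}) := by
    refine measurable_set_iff.2 fun i => ?_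
    exact ((measurable_set_mem (i, (0 : Fin 4))).and (measurable_set_mem (i, (1 : Fin 4)))).or
      ((measurable_set_mem (i, (0 : Fin 4))).not.and ((measurable_set_mem (i, (2 : Fin 4))).and
        (measurable_set_mem (i, (3 : Fin 4)))))
  have hcomp : (fun ξ : Set (ι × Fin 4) =>
      {i | ((i, 0) ∈ ξ ∧ (i, 1) ∈ ξ) ∨ ((i, 0) ∉ ξ ∧ (i, 2) ∈ ξ ∧ (i, 3) ∈ ξ)}) ∘
      (fun q : ι × Fin 4 → Prop => {k | q k}) =
        (fun q : ι → Prop => {i | q i}) ∘ (fun (h : ι → Fin 4 → Prop) (i : ι) =>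
          (h i 0 ∧ h i 1) ∨ (¬ h i 0 ∧ h i 2 ∧ h i 3)) ∘ (MeasurableEquiv.curry ι (Fin 4) Prop) := by
    funext q
    simp [MeasurableEquiv.coe_curry, Function.curry]
  have hcur : Measurable (MeasurableEquiv.curry ι (Fin 4) Prop) := MeasurableEquiv.measurable _
  rw [prodBernoulli_eq_map P, Measure.map_map hproj measurable_setOf, hcomp,
    ← Measure.map_map hset (hpi.comp hcur), ← Measure.map_map hpi hcur]
  have hcurry : (Measure.infinitePi fun k : ι × Fin 4 =>
      (toNNReal (P k) • Measure.dirac True + toNNReal (σ (P k)) • Measure.dirac False :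
        Measure Prop)).map (MeasurableEquiv.curry ι (Fin 4) Prop) =
      Measure.infinitePi fun i : ι => Measure.infinitePi fun j : Fin 4 => Ber(True, False, P (i, j)) :=
    Measure.infinitePi_map_curry (fun (i : ι) (j : Fin 4) => Ber(True, False, P (i, j)))
  have hpush : (Measure.infinitePi fun i : ι =>
      Measure.infinitePi fun j : Fin 4 => Ber(True, False, P (i, j))).map
        (fun (h : ι → Fin 4 → Prop) (i : ι) => (h i 0 ∧ h i 1) ∨ (¬ h i 0 ∧ h i 2 ∧ h i 3)) =
      Measure.infinitePi fun i : ι =>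
        (Measure.infinitePi fun j : Fin 4 => Ber(True, False, P (i, j))).map
          (fun g : Fin 4 → Prop => (g 0 ∧ g 1) ∨ (¬ g 0 ∧ g 2 ∧ g 3)) :=
    Measure.infinitePi_map_pi _ (fun _ => hor)
  rw [hcurry, hpush, prodBernoulli_eq_map]
  congr 1
  congrm Measure.infinitePi fun i => ?_
  rw [Measure.infinitePi_eq_pi]
  exact pi_bernoulli_map_block fun j => P (i, j)

/-! ## The coarse shadow of the coins of `M_k(ρ, c)` -/

/-- The parameter of the coarse shadow, `q(ρ) = ρ̂/2 + (1 - ρ̂)/4`, lies in `[0, 1]`. -/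
theorem shadowParam_mem (ρ : ℝ) :
    (Set.projIcc (0 : ℝ) 1 zero_le_one ρ : ℝ) / 2 + (1 - Set.projIcc (0 : ℝ) 1 zero_le_one ρ) / 4 ∈
      Icc (0 : ℝ) 1 := by
  have h := (Set.projIcc (0 : ℝ) 1 zero_le_one ρ).2
  simp only [mem_Icc] at h ⊢
  constructor <;> linarith [h.1, h.2]

/-- Scaling sites by `k ≠ 0` is injective. -/
theorem eq_of_kvec_eq {k : ℤ} (hk : k ≠ 0) {U U' : Site 2}
    (h : (![k * U 0, k * U 1] : Site 2) = ![k * U' 0, k * U' 1]) : U = U' := by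
  have e0 := congrFun h 0; have e1 := congrFun h 1
  simp only [Matrix.cons_val_zero, Matrix.cons_val_one, Matrix.cons_val_fin_one] at e0 e1
  ext i; fin_cases i
  · exact mul_left_cancel₀ hk e0
  · exact mul_left_cancel₀ hk e1

/-- A scaled site is not a scaled site shifted by a unit vector (`k ≥ 2`). -/
theorem kvec_ne_kvec_add {k : ℤ} (hk : 2 ≤ k) (U U' : Site 2) (d : Fin 2) :
    (![k * U 0, k * U 1] : Site 2) ≠ ![k * U' 0, k * U' 1] + (if d = 0 then ![1, 0] else ![0, 1]) := by
  intro h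
  have key : ∀ a b : ℤ, k * a ≠ k * b + 1 := fun a b hab => by
    have h1 : k ∣ 1 := ⟨a - b, by linarith [mul_sub k a b]⟩
    have := Int.le_of_dvd one_pos h1
    omega
  fin_cases d
  · have e := congrFun h 0
    simp at e
    exact key _ _ e
  · have e := congrFun h 1
    simp at e
    exact key _ _ e

/-- **The block injection is injective** (`k ≥ 2`): the selector, the shared coin and the own
coins of the sub-edges `0` and `1` of distinct coarse edges are distinct coins. -/
theorem blockInj_injective {k : ℕ} (hk : 2 ≤ k) :
    Function.Injective (fun p : (Site 2 × Fin 2) × Fin 4 =>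
      (if p.2 = 0 then (p.1.1, p.1.2, (2 : Fin 3))
        else if p.2 = 1 then (p.1.1, p.1.2, (1 : Fin 3))
        else if p.2 = 2 then ((![(k : ℤ) * p.1.1 0, (k : ℤ) * p.1.1 1] : Site 2), p.1.2, (0 : Fin 3))
        else ((![(k : ℤ) * p.1.1 0, (k : ℤ) * p.1.1 1] : Site 2) +
          (if p.1.2 = 0 then ![1, 0] else ![0, 1]), p.1.2, (0 : Fin 3)) :
        Site 2 × Fin 2 × Fin 3)) := by
  have hk0 : (k : ℤ) ≠ 0 := by exact_mod_cast (show k ≠ 0 by omega)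
  have hk2 : (2 : ℤ) ≤ k := by exact_mod_cast hk
  rintro ⟨⟨U, d⟩, j⟩ ⟨⟨U', d'⟩, j'⟩ h
  have h3 := congrArg (fun x : Site 2 × Fin 2 × Fin 3 => x.2.2) h
  have h2 := congrArg (fun x : Site 2 × Fin 2 × Fin 3 => x.2.1) h
  have h1 := congrArg (fun x : Site 2 × Fin 2 × Fin 3 => x.1) h
  fin_cases j <;> fin_cases j' <;>
    simp only [Fin.isValue, Fin.zero_eta, Fin.mk_one, Fin.reduceFinMk, Fin.reduceEq,
      ↓reduceIte] at h1 h2 h3 ⊢ <;> subst h2 <;>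
    first
    | (subst h1; rfl)
    | (cases eq_of_kvec_eq hk0 h1; rfl)
    | (cases eq_of_kvec_eq hk0 (add_right_cancel h1); rfl)
    | exact absurd h1 (kvec_ne_kvec_add hk2 U U' d)
    | exact absurd h1.symm (kvec_ne_kvec_add hk2 U' U d)

/-- The own coins of the sub-edges `0` and `1` of a coarse edge are fair (the sub-edges are
axial), the shared coin is fair and the selector has bias `ρ̂`; so every block parameter of the
coarse shadow is `q(ρ) = ρ̂/2 + (1 - ρ̂)/4`. -/
theorem blockParam_eq_shadowParam (k : ℕ) (ρ c : ℝ) (t : Site 2 × Fin 2) :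
    (⟨(refinementParam k ρ c (t.1, t.2, 2) : ℝ) * refinementParam k ρ c (t.1, t.2, 1) +
        (1 - refinementParam k ρ c (t.1, t.2, 2)) *
          (refinementParam k ρ c ((![(k : ℤ) * t.1 0, (k : ℤ) * t.1 1] : Site 2), t.2, 0) *
            refinementParam k ρ c ((![(k : ℤ) * t.1 0, (k : ℤ) * t.1 1] : Site 2) +
              (if t.2 = 0 then ![1, 0] else ![0, 1]), t.2, 0)),
      blockParam_mem ![refinementParam k ρ c (t.1, t.2, 2), refinementParam k ρ c (t.1, t.2, 1),
        refinementParam k ρ c ((![(k : ℤ) * t.1 0, (k : ℤ) * t.1 1] : Site 2), t.2, 0),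
        refinementParam k ρ c ((![(k : ℤ) * t.1 0, (k : ℤ) * t.1 1] : Site 2) +
          (if t.2 = 0 then ![1, 0] else ![0, 1]), t.2, 0)]⟩ : unitInterval) =
      ⟨_, shadowParam_mem ρ⟩ := by
  obtain ⟨U, d⟩ := t
  have hax0 : IsAxialEdge k ((![(k : ℤ) * U 0, (k : ℤ) * U 1] : Site 2), d) := by
    fin_cases d <;> simp [IsAxialEdge]
  have hax1 : IsAxialEdge k ((![(k : ℤ) * U 0, (k : ℤ) * U 1] : Site 2) +
      (if d = 0 then ![1, 0] else ![0, 1]), d) := by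
    fin_cases d <;> simp [IsAxialEdge]
  apply Subtype.ext
  simp only [refinementParam_apply_two, refinementParam_apply_one,
    refinementParam_apply_zero_of_isAxialEdge ρ c hax0,
    refinementParam_apply_zero_of_isAxialEdge ρ c hax1, coe_half]
  ring

/-- **The coarse shadow is Bernoulli bond percolation with parameter `q(ρ)`.**  Under the coin
law of `M_k(ρ, c)` (`k ≥ 2`), the set of coarse edges `{C, C + e_d}` whose block of coins shows
`(selector ∧ shared) ∨ (¬ selector ∧ own₀ ∧ own₁)` is distributed as
`bondPercolation (zdGraph 2) q(ρ)`, `q(ρ) = ρ̂/2 + (1 - ρ̂)/4`. -/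
theorem prodBernoulli_map_coarseShadow {k : ℕ} (hk : 2 ≤ k) (ρ c : ℝ)
    (T : Set (Site 2 × Fin 2 × Fin 3) → Set (Site 2 × Fin 2))
    (hT : ∀ S t, t ∈ T S ↔ ((t.1, t.2, (2 : Fin 3)) ∈ S ∧ (t.1, t.2, (1 : Fin 3)) ∈ S) ∨
      ((t.1, t.2, (2 : Fin 3)) ∉ S ∧
        (((![(k : ℤ) * t.1 0, (k : ℤ) * t.1 1] : Site 2), t.2, (0 : Fin 3)) ∈ S ∧
        (((![(k : ℤ) * t.1 0, (k : ℤ) * t.1 1] : Site 2) +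
          (if t.2 = 0 then ![1, 0] else ![0, 1]), t.2, (0 : Fin 3)) ∈ S)))) :
    (prodBernoulli (refinementParam k ρ c)).map (fun S => edgeConfig (T S)) =
      bondPercolation (zdGraph 2) ⟨_, shadowParam_mem ρ⟩ := by
  set blk : (Site 2 × Fin 2) × Fin 4 → Site 2 × Fin 2 × Fin 3 := fun p =>
    (if p.2 = 0 then (p.1.1, p.1.2, (2 : Fin 3))
      else if p.2 = 1 then (p.1.1, p.1.2, (1 : Fin 3))
      else if p.2 = 2 then ((![(k : ℤ) * p.1.1 0, (k : ℤ) * p.1.1 1] : Site 2), p.1.2, (0 : Fin 3))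
      else ((![(k : ℤ) * p.1.1 0, (k : ℤ) * p.1.1 1] : Site 2) +
        (if p.1.2 = 0 then ![1, 0] else ![0, 1]), p.1.2, (0 : Fin 3))) with hblk
  set blockRead : Set ((Site 2 × Fin 2) × Fin 4) → Set (Site 2 × Fin 2) := fun ξ =>
    {i | ((i, 0) ∈ ξ ∧ (i, 1) ∈ ξ) ∨ ((i, 0) ∉ ξ ∧ (i, 2) ∈ ξ ∧ (i, 3) ∈ ξ)} with hblockRead
  have hTeq : T = blockRead ∘ fun S => blk ⁻¹' S := by
    funext S; ext t
    rw [hT]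
    simp [hblockRead, hblk]
  have hpre : Measurable fun S : Set (Site 2 × Fin 2 × Fin 3) => blk ⁻¹' S :=
    measurable_set_iff.2 fun a => measurable_set_mem (blk a)
  have hread : Measurable blockRead := by
    refine measurable_set_iff.2 fun i => ?_
    exact ((measurable_set_mem (i, (0 : Fin 4))).and (measurable_set_mem (i, (1 : Fin 4)))).or
      ((measurable_set_mem (i, (0 : Fin 4))).not.and ((measurable_set_mem (i, (2 : Fin 4))).and
        (measurable_set_mem (i, (3 : Fin 4)))))
  rw [show (fun S => edgeConfig (T S)) = edgeConfig ∘ T from rfl, hTeq,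
    ← Measure.map_map measurable_edgeConfig (hread.comp hpre), ← Measure.map_map hread hpre,
    prodBernoulli_map_preimage _ (blockInj_injective hk), hblockRead, prodBernoulli_map_block]
  have hparam : (fun i : Site 2 × Fin 2 => (⟨(refinementParam k ρ c (blk (i, 0)) : ℝ) *
      refinementParam k ρ c (blk (i, 1)) + (1 - refinementParam k ρ c (blk (i, 0))) *
        (refinementParam k ρ c (blk (i, 2)) * refinementParam k ρ c (blk (i, 3))),
      blockParam_mem fun j => refinementParam k ρ c (blk (i, j))⟩ : unitInterval)) =
      fun _ => ⟨_, shadowParam_mem ρ⟩ := by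
    funext i
    have h := blockParam_eq_shadowParam k ρ c i
    apply Subtype.ext
    have h' := congrArg Subtype.val h
    simpa [hblk] using h'
  rw [hparam, prodBernoulli_const, setBernoulli_univ_map_edgeConfig]

/-! ## Fully open coarse edges lie in the coarse shadow -/

/-- The sub-edge `{(i, kC₁), (i+1, kC₁)}` of a coarse row, `kC₀ ≤ i ≤ kC₀ + 1`, read from the
coins: it is axial with tuple base `C`, so it is open iff
`(selector ∧ shared) ∨ (¬ selector ∧ own coin of (i, kC₁))`. -/
theorem subedge_h_open_iff {k : ℕ} (hk : 2 ≤ k) (S : Set (Site 2 × Fin 2 × Fin 3)) (C : Site 2)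
    {i : ℤ} (hi : i = (k : ℤ) * C 0 ∨ i = (k : ℤ) * C 0 + 1) :
    s((![i, (k : ℤ) * C 1] : Site 2), ![i + 1, (k : ℤ) * C 1]) ∈ refinementConfig k S ↔
      ((C, (0 : Fin 2), (2 : Fin 3)) ∈ S ∧ (C, (0 : Fin 2), (1 : Fin 3)) ∈ S) ∨
        ((C, (0 : Fin 2), (2 : Fin 3)) ∉ S ∧ ((![i, (k : ℤ) * C 1] : Site 2), (0 : Fin 2), (0 : Fin 3)) ∈ S) := by
  have hk0 : (k : ℤ) ≠ 0 := by exact_mod_cast (show k ≠ 0 by omega)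
  have he : s((![i, (k : ℤ) * C 1] : Site 2), ![i + 1, (k : ℤ) * C 1]) =
      cornerEdge ((![i, (k : ℤ) * C 1] : Site 2), 0) := by
    rw [cornerEdge_zero]
    congr 2; ext j; fin_cases j <;> simp
  have hax : IsAxialEdge k ((![i, (k : ℤ) * C 1] : Site 2), 0) := by simp
  have htb : tupleBase k ((![i, (k : ℤ) * C 1] : Site 2), 0) = C := by
    ext j; fin_cases j
    · simp only [tupleBase_apply, Fin.zero_eta, Matrix.cons_val_zero]
      rcases hi with rfl | rfl
      · exact Int.mul_ediv_cancel_left _ hk0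
      · rw [add_comm, Int.add_mul_ediv_left _ _ hk0,
          Int.ediv_eq_zero_of_lt (by norm_num) (by omega), zero_add]
    · simp only [tupleBase_apply, Fin.mk_one, Matrix.cons_val_one, Matrix.cons_val_fin_one]
      exact Int.mul_ediv_cancel_left _ hk0
  rw [he, cornerEdge_mem_refinementConfig_iff, refinementOpen_of_isAxialEdge S hax, htb]

/-- Vertical companion of `subedge_h_open_iff`. -/
theorem subedge_v_open_iff {k : ℕ} (hk : 2 ≤ k) (S : Set (Site 2 × Fin 2 × Fin 3)) (C : Site 2)
    {i : ℤ} (hi : i = (k : ℤ) * C 1 ∨ i = (k : ℤ) * C 1 + 1) :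
    s((![(k : ℤ) * C 0, i] : Site 2), ![(k : ℤ) * C 0, i + 1]) ∈ refinementConfig k S ↔
      ((C, (1 : Fin 2), (2 : Fin 3)) ∈ S ∧ (C, (1 : Fin 2), (1 : Fin 3)) ∈ S) ∨
        ((C, (1 : Fin 2), (2 : Fin 3)) ∉ S ∧ ((![(k : ℤ) * C 0, i] : Site 2), (1 : Fin 2), (0 : Fin 3)) ∈ S) := by
  have hk0 : (k : ℤ) ≠ 0 := by exact_mod_cast (show k ≠ 0 by omega)
  have he : s((![(k : ℤ) * C 0, i] : Site 2), ![(k : ℤ) * C 0, i + 1]) =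
      cornerEdge ((![(k : ℤ) * C 0, i] : Site 2), 1) := by
    rw [cornerEdge_one]
    congr 2; ext j; fin_cases j <;> simp
  have hax : IsAxialEdge k ((![(k : ℤ) * C 0, i] : Site 2), 1) := by simp
  have htb : tupleBase k ((![(k : ℤ) * C 0, i] : Site 2), 1) = C := by
    ext j; fin_cases j
    · simp only [tupleBase_apply, Fin.zero_eta, Matrix.cons_val_zero]
      exact Int.mul_ediv_cancel_left _ hk0
    · simp only [tupleBase_apply, Fin.mk_one, Matrix.cons_val_one, Matrix.cons_val_fin_one]
      rcases hi with rfl | rfl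
      · exact Int.mul_ediv_cancel_left _ hk0
      · rw [add_comm, Int.add_mul_ediv_left _ _ hk0,
          Int.ediv_eq_zero_of_lt (by norm_num) (by omega), zero_add]
  rw [he, cornerEdge_mem_refinementConfig_iff, refinementOpen_of_isAxialEdge S hax, htb]

/-- **A coarse horizontal edge whose sub-edges `0` and `1` are open lies in the coarse shadow.** -/
theorem coarse_mem_shadow_h {k : ℕ} (hk : 2 ≤ k) (S : Set (Site 2 × Fin 2 × Fin 3))
    (T : Set (Site 2 × Fin 2 × Fin 3) → Set (Site 2 × Fin 2))
    (hT : ∀ S t, t ∈ T S ↔ ((t.1, t.2, (2 : Fin 3)) ∈ S ∧ (t.1, t.2, (1 : Fin 3)) ∈ S) ∨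
      ((t.1, t.2, (2 : Fin 3)) ∉ S ∧
        (((![(k : ℤ) * t.1 0, (k : ℤ) * t.1 1] : Site 2), t.2, (0 : Fin 3)) ∈ S ∧
        (((![(k : ℤ) * t.1 0, (k : ℤ) * t.1 1] : Site 2) +
          (if t.2 = 0 then ![1, 0] else ![0, 1]), t.2, (0 : Fin 3)) ∈ S))))
    (C : Site 2) (h : ∀ i : ℤ, (k : ℤ) * C 0 ≤ i → i < (k : ℤ) * C 0 + k →
      s((![i, (k : ℤ) * C 1] : Site 2), ![i + 1, (k : ℤ) * C 1]) ∈ refinementConfig k S) :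
    s(C, C + ![1, 0]) ∈ edgeConfig (T S) := by
  have hk2 : (2 : ℤ) ≤ k := by exact_mod_cast hk
  have h0 := (subedge_h_open_iff hk S C (Or.inl rfl)).1 (h _ le_rfl (by linarith))
  have h1 := (subedge_h_open_iff hk S C (Or.inr rfl)).1 (h _ (by linarith) (by linarith))
  rw [← cornerEdge_zero, cornerEdge_mem_edgeConfig_iff, hT]
  have e : (![(k : ℤ) * C 0, (k : ℤ) * C 1] : Site 2) + ![1, 0] = ![(k : ℤ) * C 0 + 1, (k : ℤ) * C 1] := by
    ext j; fin_cases j <;> simp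
  simp only [Fin.isValue, ↓reduceIte, e]
  tauto

/-- **A coarse vertical edge whose sub-edges `0` and `1` are open lies in the coarse shadow.** -/
theorem coarse_mem_shadow_v {k : ℕ} (hk : 2 ≤ k) (S : Set (Site 2 × Fin 2 × Fin 3))
    (T : Set (Site 2 × Fin 2 × Fin 3) → Set (Site 2 × Fin 2))
    (hT : ∀ S t, t ∈ T S ↔ ((t.1, t.2, (2 : Fin 3)) ∈ S ∧ (t.1, t.2, (1 : Fin 3)) ∈ S) ∨
      ((t.1, t.2, (2 : Fin 3)) ∉ S ∧
        (((![(k : ℤ) * t.1 0, (k : ℤ) * t.1 1] : Site 2), t.2, (0 : Fin 3)) ∈ S ∧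
        (((![(k : ℤ) * t.1 0, (k : ℤ) * t.1 1] : Site 2) +
          (if t.2 = 0 then ![1, 0] else ![0, 1]), t.2, (0 : Fin 3)) ∈ S))))
    (C : Site 2) (h : ∀ i : ℤ, (k : ℤ) * C 1 ≤ i → i < (k : ℤ) * C 1 + k →
      s((![(k : ℤ) * C 0, i] : Site 2), ![(k : ℤ) * C 0, i + 1]) ∈ refinementConfig k S) :
    s(C, C + ![0, 1]) ∈ edgeConfig (T S) := by
  have hk2 : (2 : ℤ) ≤ k := by exact_mod_cast hk
  have h0 := (subedge_v_open_iff hk S C (Or.inl rfl)).1 (h _ le_rfl (by linarith))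
  have h1 := (subedge_v_open_iff hk S C (Or.inr rfl)).1 (h _ (by linarith) (by linarith))
  rw [← cornerEdge_one, cornerEdge_mem_edgeConfig_iff, hT]
  have e : (![(k : ℤ) * C 0, (k : ℤ) * C 1] : Site 2) + ![0, 1] = ![(k : ℤ) * C 0, (k : ℤ) * C 1 + 1] := by
    ext j; fin_cases j <;> simp
  simp only [Fin.isValue, one_ne_zero, ↓reduceIte, e]
  tauto

end Summit.CriticalPhenomena.CardyFormulaZ2.Theorems.CardySelfRefinement

end
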